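import Literature.NumberTheory.FaltingsSerre.ParamodularTemplate
import HarnessLib

/-!
# The Faltings–Serre method after Brumer–Pacetti–Poor–Tornaría–Voight–Yuen, VII:
# the instance `N = 349` (certificate `certs/349/certificate.canonical.json`, sha256 `0b9d070d407f6211…`)

[BPPTVY] = A. Brumer, A. Pacetti, C. Poor, G. Tornaría, J. Voight, D. S. Yuen, *On the paramodularity of
typical abelian surfaces*, Algebra & Number Theory **13**:5 (2019) 1145–1195 [cite: BrumerEtAl2019].
[PY15] = C. Poor, D. S. Yuen, *Paramodular cusp forms*, Math. Comp. **84** (2015) 1401–1438, Table 5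
(the level-349 nonlift eigenform `f₃₄₉`) [cite: PoorYuen2015].  [PSY] = C. Poor, J. Shurman, D. S. Yuen,
*Nonlift weight two paramodular eigenform constructions*, J. Korean Math. Soc. 57 (2020) (the formula
`f₃₄₉ = Q/L` in Gritsenko lifts of theta blocks, file `QL-349.txt` of the authors' website).

This file is the `N = 349` INSTANCE of the template `paramodular_of_surfaceCertificate`
(`ParamodularTemplate.lean`): the abelian surface `A = Jac(C₃₄₉)`, `C₃₄₉ : y² + (x³+x²+x+1)y = −x³−x²`
(LMFDB `349.a.349.1`), is paramodular of level `349` away from `349`, GIVEN (i) the cited Faltings–Serre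
criterion `hFS` ([BPPTVY, Thm 2.1.5], a hypothesis — see `CriterionProofs.lean` for its discharge
`traceEq_of_faltingsSerre_symplectic_holds`), (ii) the Arthur-dependent input `hρf` ([BPPTVY, Thm 4.3.4]),
and (iii) the CERTIFICATE `Certificate349` = `SurfaceCertificate 349 checkPrimes349`, a hypothesis
discharged outside the kernel by the cell's merged certificate `certs/349/certificate.canonical.json`
(sha256 `0b9d070d407f6211ba094695ef509e92c9ce0838fa2e62a6110db86c60cabd92`), every datum by two independent implementations.
No new mathematics is proved here; paramodularity of `A₃₄₉` is NOT a published theorem ([PY15, Table 5]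
lists `f₃₄₉` conjecturally; [BPPTVY] treats `N = 277, 353, 587` only), which is why the certificate is a
binder and this file asserts only the implication.
-/

noncomputable section

namespace Literature.NumberTheory.FaltingsSerre.Paramodular349

open Polynomial IsDedekindDomain
open Literature.NumberTheory.FaltingsSerre Literature.NumberTheory.GaloisRepresentations
  Literature.NumberTheory.Automorphic.Paramodular Literature.NumberTheory.Automorphic
  Literature.AlgebraicGeometry.Motives
open scoped NumberField

/-- The check primes `P(349)` of the lead certificate (finest-invariant obstruction search on the
class-field data of `K₀ = ℚ(r₄+r₅)`, degree 10, `4095` quadratic extensions; two independent search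
implementations agree): `{3,5,7,11,13,17,19,23,29,31,43}`. [cite: BrumerEtAl2019, Alg 2.4.1 p. 1156 (the algorithm producing such a set)] -/
def checkPrimes349 : Finset ℕ := {3, 5, 7, 11, 13, 17, 19, 23, 29, 31, 43}

/-- Data check: eleven check primes, `43` the largest, `37` and `41` absent. [folklore] -/
theorem checkPrimes349_card : checkPrimes349.card = 11 ∧ 43 ∈ checkPrimes349 ∧ 37 ∉ checkPrimes349 ∧ 41 ∉ checkPrimes349 := by
  simp [checkPrimes349]

/-- **The `N = 349` certificate, as a hypothesis**: `SurfaceCertificate 349 checkPrimes349 J ν ρA ρf`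
(`ParamodularTemplate.lean`; fields `similitude₁₂`, `det_isUnit`, `transpose_eq`, `diag_eq`,
`unramified₁₂`, `absIrreducible`, `residual_eq`, `complete`, `traces` of `Certificate`).  Discharged
OUTSIDE THE KERNEL by `certs/349/certificate.canonical.json` (sha256 `0b9d070d407f6211ba094695ef509e92c9ce0838fa2e62a6110db86c60cabd92`) — blocks:
`residual` (image `S₅(b)`: `ℚ(A[2])` has quintic resolvent `x⁵+x⁴+2x³−2x²+x+1`, Galois group `S₅`;
`ρ̄_f ≃ ρ̄_A` by Route T: transvection + an order-5 Frobenius, `Q₃(f₃₄₉) ≡ Φ₅ (mod 2)` ×2, candidate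
fields from the LMFDB — completeness CITED), `classfield`/`group_theory`/`obstructing` (`K₀` degree 10,
`4095` extensions, check primes = `checkPrimes349`), `trace_check` (`a_p(A₃₄₉) = a_p(f₃₄₉)` on
`checkPrimes349`, each side by two implementations). [cite: BrumerEtAl2019, Alg 2.4.1 p. 1156; Thm 2.1.5 p. 1150] -/
def Certificate349 (J : Matrix (Fin 4) (Fin 4) ℤ_[2]) (ν : Field.absoluteGaloisGroup ℚ → ℤ_[2])
    (ρA ρf : FramedGaloisRep ℚ ℤ_[2] 4) : Prop :=
  SurfaceCertificate 349 checkPrimes349 J ν ρA ρf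

/-- **`A₃₄₉` is paramodular of level `349` away from `349`, from the certificate.**  Binders exactly as
in `paramodular_of_surfaceCertificate` with `N = 349`, `T = checkPrimes349`; `h2` is the hand check
`L_2(A,T) = Q_2(f,T)` (`a_2 = −2` both sides). [cite: BrumerEtAl2019, Thm 2.1.5 p. 1150; Thm 4.3.4 p. 1169; Alg 2.4.1 p. 1156] -/
theorem paramodular_349 (hFS : traceEq_of_faltingsSerre_symplectic)
    {A : AbelianVariety ℚ} {f : Matrix (Fin 2) (Fin 2) ℂ → ℂ}
    {ρA ρf : FramedGaloisRep ℚ ℤ_[2] 4} {J : Matrix (Fin 4) (Fin 4) ℤ_[2]}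
    {ν : Field.absoluteGaloisGroup ℚ → ℤ_[2]}
    {b : Module.Basis (Fin 4) ℚ_[2] (A.rationalTateModule 2)}
    (hC : Certificate349 J ν ρA ρf)
    (hframe : A.IsFrameOfTateRep 2 b (rationalize ρA))
    (aA bA af bf : ℕ → ℤ)
    (hA : ∀ p : ℕ, p.Prime → ¬ p ∣ 349 →
      A.HasGoodEulerFactorAt p ((lPolynomialOfSurface p (aA p) (bA p)).map (Int.castRingHom ℚ)))
    (hρf : ∀ p : ℕ, p.Prime → ¬ p ∣ 349 → p ≠ 2 →
      ∀ v : HeightOneSpectrum (𝓞 ℚ), ((p : ℕ) : 𝓞 ℚ) ∈ v.asIdeal →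
        ρf.HasFrobCharpolyAt v
          ((lPolynomialOfSurface p (af p) (bf p)).reverse.map (Int.castRingHom ℤ_[2])))
    (hcusp : IsParamodularCuspForm 349 2 f) (hne : ∃ Z ∈ siegelUpperHalfSpace 2, f Z ≠ 0)
    (hfe : ∀ p : ℕ, p.Prime → ¬ p ∣ 349 →
      HasSpinorEulerFactorAt 2 p f ((lPolynomialOfSurface p (af p) (bf p)).map (Int.castRingHom ℂ)))
    (h2 : aA 2 = af 2 ∧ bA 2 = bf 2) :
    IsParamodularAwayFrom A 349 f :=
  paramodular_of_surfaceCertificate hFS hC hframe aA bA af bf hA hρf hcusp hne hfe (fun _ => h2)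

/-- The conclusion at one prime `p ≠ 349`: one polynomial is both `L_p(A₃₄₉,T)` and `Q_p(f₃₄₉,T)`. [cite: BrumerEtAl2019, Thm 7.1.3 p. 1187 (shape of the statement)] -/
theorem eulerFactors_agree_349 {A : AbelianVariety ℚ} {f : Matrix (Fin 2) (Fin 2) ℂ → ℂ}
    (h : IsParamodularAwayFrom A 349 f) {p : ℕ} (hp : p.Prime) (hpN : p ≠ 349) :
    ∃ Q : Polynomial ℚ, HasSpinorEulerFactorAt 2 p f (Q.map (algebraMap ℚ ℂ)) ∧
      A.HasGoodEulerFactorAt p Q :=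
  eulerFactors_agree_of_prime (by norm_num) h hp hpN

end Literature.NumberTheory.FaltingsSerre.Paramodular349

end
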